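import Mathlib
import Literature.Computability.Complexity.RangeAvoidance
import Literature.Computability.Complexity.SignDegreeXor
import HarnessLib.Audit
import Summits.PneNP.PneNP.Theorems.PstarSA2Blind
import Summits.PneNP.PneNP.Theorems.PstarTyped
import Summits.PneNP.PneNP.Theorems.PairwiseSALevel
import Summits.PneNP.PneNP.Theorems.QuotientSAHeadline

/-!
# ROUND-23 seed: Sherali–Adams blindness BELOW THE `n^{3/2}` THRESHOLD (density-uniform level bounds; cell `pnp-ideate`)

FRONTIER range-avoidance ladder, rung F-N3 context (restricted-model lower bounds for the Sherali–Adams hierarchy — nothing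
here bears on `P` vs `NP`).

Print solves `NC⁰₄`-AVOID (hence pure-`P⋆` avoidance) deterministically from `m ≥ c⁴ n^{3/2} log n` outputs by REFUTATION
certificates (GuruswamiLyuYuan2025, the docstring of `PstarIsolation.PstarAvoidLinearFP`).  ROUND-21/22 showed that at LINEAR stretch
`m = C n` linear-level Sherali–Adams refutes nothing (before and after the exact XOR quotient).  This file types the DENSITY-UNIFORM
form that closes the gap between the two: at stretch `m = Δ·n` Sherali–Adams is blind at every level `r` with
`c_t · Δ^{2t} · r^{t−1} ≤ n^{t−1}`, i.e. up to level `n / (c_t^{1/(t−1)} Δ^{2t/(t−1)})`, for every `t ≥ 2` — so for `m = n^{3/2−ε}`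
(`Δ = n^{1/2−ε}`) and `t > 1/(2ε)` the blind level is polynomial, `n^{(2εt−1)/(t−1)}`; the SA refutation route to `P⋆`-AVOID is closed
exactly below the print threshold `n^{3/2}`.  Mechanism: the hub `PairwiseSALinearLevel` at boundary ratio `(k−3) + 1/t`
(`a = (k−3)t + 1`, `b = t`) and the first-moment existence of `(r, (k−3)+1/t)`-boundary-expanding pure instances with `Δ n`
outputs, whose union bound has slack exponent `(t−1)/(2t)` per output (`t = 2` is the linear-stretch computation already in the
tree: `IP3ExpandingExist`, `PstarExpandingExist`, radius `n / (c·C⁴)`).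

* `IP3ExpandingDensity` (target T23.1-A, arity `6`, ratio `(3t+1)/t`) and the headline-after-quotient form
  `IP3SASubThresholdBlind` with its wiring `ip3SASubThresholdBlind_of` (PROVED from the hub + `IP3PairwiseLaws` + T23.1-A);
* `TypedPairwiseLaws` (target T23.1-C: the ROUND-21 typed fibre laws — XOR variables unbiased, AND variables `1/√2`-biased — in the
  `PairwiseSALevel.PairwiseLaws` format), `PstarExpandingDensity` (target T23.1-B, arity `4`, ratio `(t+1)/t`, typed pure `P⋆`) and
  the headline form in the literal `NC⁰₄` model of GuruswamiLyuYuan2025, `PstarSASubThresholdBlind`, with its wiring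
  `pstarSASubThresholdBlind_of` (PROVED).

Honest scope: Sherali–Adams only (the `n^{3/2}` algorithms use spectral / SOS-type certificates; SOS after the quotient is the named
open problem W4′); the statements are "for infinitely many `n`" per `(t, Δ)`, with one constant `c_t` for all densities `Δ`.
-/

set_option linter.dupNamespace false

open Finset
open Literature.Computability.Complexity
open Summit.PneNP.PneNP.Theorems.PstarSA2Blind (exists_not_mem_range)
open Summit.PneNP.PneNP.Theorems.PstarSALevel (SAFeasible)
open Summit.PneNP.PneNP.Theorems.PstarSASDPLevel (BoundaryExpandingQ)
open Summit.PneNP.PneNP.Theorems.PstarTyped (Typed)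
open Summit.PneNP.PneNP.Theorems.PairwiseSALevel (PairwiseLaws SAFeasibleAt PairwiseSALinearLevel)
open Summit.PneNP.PneNP.Theorems.QuotientSAHeadline (IP3PairwiseLaws)

namespace Summit.PneNP.PneNP.Theorems.SASubThreshold

/-! ### After the quotient: pure `IP₃` at every density -/

/-- **T23.1-A (target).**  Density-uniform boundary expansion for pure `IP₃`: for every `t ≥ 2` there is `c > 0` such that for
all `Δ ≥ 1` and infinitely many `n` some pure-`IP₃` instance with exactly `Δ·n` outputs is `(r, (3t+1)/t)`-boundary expanding for
every radius `r` with `c · Δ^{2t} · r^{t−1} ≤ n^{t−1}` (first moment over injective `6`-slot maps; slack exponent `(t−1)/(2t)`). -/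
@[conjecture] def IP3ExpandingDensity : Prop :=
  ∀ t : ℕ, 2 ≤ t → ∃ c : ℕ, 0 < c ∧ ∀ Δ N : ℕ, 1 ≤ Δ → ∃ n, N ≤ n ∧
    ∃ I : LocalMap 6 n (Δ * n), I.IsPure (ipPred 3) ∧
      ∀ r : ℕ, c * Δ ^ (2 * t) * r ^ (t - 1) ≤ n ^ (t - 1) → BoundaryExpandingQ (3 * t + 1) t r I

/-- **HEADLINE-23-A (after the quotient).**  For every `t ≥ 2` there is `c > 0` such that for every density `Δ ≥ 2` and
infinitely many `n` some pure-`IP₃` `6`-local map with `Δ·n` outputs has a point outside its range while Sherali–Adams of every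
level `r` with `c · Δ^{2t} · r^{t−1} ≤ n^{t−1}` is feasible for EVERY target. -/
def IP3SASubThresholdBlind : Prop :=
  ∀ t : ℕ, 2 ≤ t → ∃ c : ℕ, 0 < c ∧ ∀ Δ N : ℕ, 2 ≤ Δ → ∃ n, N ≤ n ∧
    ∃ I : LocalMap 6 n (Δ * n), I.IsPure (ipPred 3) ∧ (∃ y, y ∉ I.range) ∧
      ∀ (y : Fin (Δ * n) → Bool) (r : ℕ), c * Δ ^ (2 * t) * r ^ (t - 1) ≤ n ^ (t - 1) → SAFeasible r I y

/-- Constant folding: `c₁ Δ^{2t} (c₀ r)^{t−1} = (c₁ c₀^{t−1}) Δ^{2t} r^{t−1}`. -/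
theorem fold_const (c₀ c₁ Δ t r : ℕ) :
    c₁ * Δ ^ (2 * t) * (c₀ * r) ^ (t - 1) = c₁ * c₀ ^ (t - 1) * Δ ^ (2 * t) * r ^ (t - 1) := by
  rw [mul_pow]; ring

/-- **HEADLINE-23-A by name** from the hub, the `IP₃` laws and density-uniform expansion. -/
theorem ip3SASubThresholdBlind_of (h0 : PairwiseSALinearLevel) (h1 : IP3PairwiseLaws) (h2 : IP3ExpandingDensity) :
    IP3SASubThresholdBlind := by
  intro t ht
  obtain ⟨c₀, hc₀, H⟩ := h0 6 (3 * t + 1) t (by norm_num) (by omega)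
  obtain ⟨c₁, hc₁, hE⟩ := h2 t ht
  refine ⟨c₁ * c₀ ^ (t - 1), Nat.mul_pos hc₁ (pow_pos hc₀ _), fun Δ N hΔ => ?_⟩
  obtain ⟨n, hNn, I, hP, hB⟩ := hE Δ (max N 1) (by omega)
  have hn1 : 1 ≤ n := le_trans (le_max_right N 1) hNn
  have hnm : n < Δ * n := by nlinarith
  refine ⟨n, le_trans (le_max_left N 1) hNn, I, hP, exists_not_mem_range I hnm, fun y r hr => ?_⟩
  obtain ⟨p, μ, hL⟩ := h1 n (Δ * n) I hP y
  have hinj : ∀ j, Function.Injective (I.vars j) := fun j => hP.2 j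
  have hB' : BoundaryExpandingQ (3 * t + 1) t (c₀ * r) I := hB (c₀ * r) (by rw [fold_const]; exact hr)
  have h := (H n (Δ * n) (c₀ * r) I y p μ hinj hL hB').saFeasible_of_injective hinj (by norm_num)
  rwa [Nat.mul_div_cancel_left r hc₀] at h

/-! ### Before the quotient: typed pure `P⋆` at every density (the literal `NC⁰₄` model) -/

/-- **T23.1-C (target).**  The ROUND-21 typed fibre laws in the hub's format: every typed pure-`P⋆` system carries
pairwise-independent fibre laws with variable-consistent biases (XOR variables `1/2`, AND variables `1/√2`). -/
@[conjecture] def TypedPairwiseLaws : Prop :=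
  ∀ (n m : ℕ) (I : LocalMap 4 n m), I.IsPure xorAndPred → Typed I → ∀ y : Fin m → Bool,
    ∃ (p : Fin n → ℝ) (μ : Fin m → (Fin 4 → Bool) → ℝ), PairwiseLaws I y p μ

/-- **T23.1-B (target).**  Density-uniform boundary expansion for typed pure `P⋆`: for every `t ≥ 2` there is `c > 0` such
that for all `Δ ≥ 1` and infinitely many `n` some typed pure-`P⋆` instance with exactly `Δ·n` outputs is `(r, (t+1)/t)`-boundary
expanding for every radius `r` with `c · Δ^{2t} · r^{t−1} ≤ n^{t−1}`. -/
@[conjecture] def PstarExpandingDensity : Prop :=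
  ∀ t : ℕ, 2 ≤ t → ∃ c : ℕ, 0 < c ∧ ∀ Δ N : ℕ, 1 ≤ Δ → ∃ n, N ≤ n ∧
    ∃ I : LocalMap 4 n (Δ * n), I.IsPure xorAndPred ∧ Typed I ∧
      ∀ r : ℕ, c * Δ ^ (2 * t) * r ^ (t - 1) ≤ n ^ (t - 1) → BoundaryExpandingQ (t + 1) t r I

/-- **HEADLINE-23-B (the `NC⁰₄` model of GuruswamiLyuYuan2025).**  For every `t ≥ 2` there is `c > 0` such that for every
density `Δ ≥ 2` and infinitely many `n` some pure-`P⋆` `4`-local map with `Δ·n` outputs has a point outside its range while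
Sherali–Adams of every level `r` with `c · Δ^{2t} · r^{t−1} ≤ n^{t−1}` is feasible for EVERY target. -/
def PstarSASubThresholdBlind : Prop :=
  ∀ t : ℕ, 2 ≤ t → ∃ c : ℕ, 0 < c ∧ ∀ Δ N : ℕ, 2 ≤ Δ → ∃ n, N ≤ n ∧
    ∃ I : LocalMap 4 n (Δ * n), I.IsPure xorAndPred ∧ (∃ y, y ∉ I.range) ∧
      ∀ (y : Fin (Δ * n) → Bool) (r : ℕ), c * Δ ^ (2 * t) * r ^ (t - 1) ≤ n ^ (t - 1) → SAFeasible r I y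

/-- **HEADLINE-23-B by name** from the hub, the typed laws and density-uniform typed expansion. -/
theorem pstarSASubThresholdBlind_of (h0 : PairwiseSALinearLevel) (h1 : TypedPairwiseLaws) (h2 : PstarExpandingDensity) :
    PstarSASubThresholdBlind := by
  intro t ht
  obtain ⟨c₀, hc₀, H⟩ := h0 4 (t + 1) t (by norm_num) (by omega)
  obtain ⟨c₁, hc₁, hE⟩ := h2 t ht
  refine ⟨c₁ * c₀ ^ (t - 1), Nat.mul_pos hc₁ (pow_pos hc₀ _), fun Δ N hΔ => ?_⟩
  obtain ⟨n, hNn, I, hP, hT, hB⟩ := hE Δ (max N 1) (by omega)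
  have hn1 : 1 ≤ n := le_trans (le_max_right N 1) hNn
  have hnm : n < Δ * n := by nlinarith
  refine ⟨n, le_trans (le_max_left N 1) hNn, I, hP, exists_not_mem_range I hnm, fun y r hr => ?_⟩
  obtain ⟨p, μ, hL⟩ := h1 n (Δ * n) I hP hT y
  have hinj : ∀ j, Function.Injective (I.vars j) := fun j => hP.2 j
  have hB' : BoundaryExpandingQ (t + 1) t (c₀ * r) I := hB (c₀ * r) (by rw [fold_const]; exact hr)
  have h := (H n (Δ * n) (c₀ * r) I y p μ hinj hL hB').saFeasible_of_injective hinj (by norm_num)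
  rwa [Nat.mul_div_cancel_left r hc₀] at h

/-! ### Sanity: the linear-stretch headlines are the case `Δ = C`, `t = 2` -/

/-- At `t = 2` the density form gives back linear level at linear stretch: level `n / (c Δ⁴)` satisfies the radius condition. -/
theorem level_at_two (c Δ n : ℕ) (hc : 0 < c) (hΔ : 1 ≤ Δ) :
    c * Δ ^ (2 * 2) * (n / (c * Δ ^ 4)) ^ (2 - 1) ≤ n ^ (2 - 1) := by
  have hpos : 0 < c * Δ ^ 4 := Nat.mul_pos hc (pow_pos hΔ _)
  simpa using Nat.mul_div_le n (c * Δ ^ 4)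

end Summit.PneNP.PneNP.Theorems.SASubThreshold
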